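import Literature.Computability.AlgebraicComplexity.AlderStrassenProofs
import Literature.Computability.AlgebraicComplexity.DDS21BloatedRatioDeborder
import Literature.Computability.AlgebraicComplexity.OrbitClosure
import Mathlib.Analysis.Complex.Polynomial.Basic
import HarnessLib

/-!
# Zariski closure of `Σ^{[k]}Π^{[d]}Σ` lies in its `F(ε)`-border (DDS 2021, Def. 2.1), `k ≥ 1`

Source currencies: Mulmuley–Sohoni 2001 §4 / Bürgisser–Landsberg–Manivel–Weyman 2011 Def. 9.3.1 —
the border of a class as the ZARISKI CLOSURE of the set of coefficient vectors (the tree's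
`zariskiClosure`, `coeffVec`, `OrbitClosure.lean`); Dutta–Dwivedi–Saxena FOCS 2021 Def. 2.1/2.3 —
the border as the set of `ε → 0` limits of `F(ε)`-circuits with `F[ε]`-integral coefficients (the
tree's `DDS2021.border`, `DDS2021.spsClass`, `DDS2021.IsEpsApprox`, `DDS21BorderDepthThree.lean`);
Medini–Shpilka 2021 Def. 9 — the syntactic class `Σ^{[k]}Π^{[d]}Σ` (the tree's `MS2021.IsSPS`).

## What is proved

`EpsZariski.epsOfZariskiSPS : ∀ n k d (f : MvPolynomial (Fin n) ℂ), 1 ≤ k →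
coeffVec f ∈ zariskiClosure (coeffVec '' {g | MS2021.IsSPS k d g}) →
f ∈ DDS2021.border (DDS2021.spsClass (RatFunc ℂ) n k d)`, and the same over every algebraically
closed field (`border_of_zariski`).  Proof (BCS Lemma (20.28) / proof of Thm. (20.24), the tree's
curve-selection lemma `exists_curve_of_ker_bind₁_le` formalised for Alder's theorem): the
coefficient map `Φ` of the GENERIC `Σ^{[k]}Π^{[d]}Σ` circuit (`genSPS`) is homogeneous of degree `d`
in the `k·d·(n+1)` slot variables (`coeffHom_genSPS`); a point `f` of the closure of its image is
`Φ(p(ε)) = f ε^h + O(ε^{h+1})` along polynomial curves `p(ε)`; dividing the first affine form of every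
product gate by `ε^h` (`C_mul_sps`, needs `d ≥ 1`; `d = 0` and `k = 0` are the constant / zero
classes, `border_of_zariski_zero`) exhibits `g = f + ε·Q ∈ Σ^{[k]}Π^{[d]}Σ(F(ε))`, an
`ε`-approximation in the sense of `DDS2021.isEpsApprox_iff_exists_map`.  No named facts, no `sorry`;
census +0.  Honest framing: closure bookkeeping (folklore "Zariski border = ε-border over
algebraically closed fields", BCS §20.6, Bürgisser 2004 §2, here for one syntactic class); together
with `DDS2021_thm_3_2_holds` it puts the Zariski closure of constant-top-fan-in depth-three circuits
into `VBP`; nothing here bears on VP versus VNP.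

References: [BurgisserClausenShokrollahi1997] Lemma (20.28), Thm. (20.24); [DuttaDwivediSaxena2022]
Def. 2.1, Def. 2.3, Thm. 3.2; [MediniShpilka2021] Def. 9; [Burgisser2004] §2; [BurgisserEtAl2011]
Def. 9.3.1; [MulmuleySohoni2001] §4.
-/

noncomputable section

namespace Literature.Computability.AlgebraicComplexity

open MvPolynomial Finset

namespace EpsZariski

/-! ## The generic `Σ^{[k]}Π^{[d]}Σ` circuit -/

section Generic

variable {R : Type*} [CommSemiring R] {n k d : ℕ}

/-- The affine form `b(none) + ∑_v b(some v)·x_v` with coefficient table `b`. [cite: MediniShpilka2021, Def 3] -/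
def affForm (b : Option (Fin n) → R) : MvPolynomial (Fin n) R :=
  C (b none) + ∑ v : Fin n, C (b (some v)) * X v

/-- The `Σ^{[k]}Π^{[d]}Σ` circuit with coefficient table `a`: `∑_{i<k} ∏_{j<d} ℓ_{ij}`.
[cite: MediniShpilka2021, Def 3] [cite: DuttaDwivediSaxena2022, Def. 2.3] -/
def sps (a : Fin k → Fin d → Option (Fin n) → R) : MvPolynomial (Fin n) R :=
  ∑ i : Fin k, ∏ j : Fin d, affForm (a i j)

/-- `MS2021.IsSPS k d f ↔ f = sps a` for some table `a` (unfolding). [cite: MediniShpilka2021, Def 3] -/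
theorem isSPS_iff {K : Type*} [Field K] {f : MvPolynomial (Fin n) K} :
    MS2021.IsSPS k d f ↔ ∃ a : Fin k → Fin d → Option (Fin n) → K, f = sps a := Iff.rfl

/-- Scaling a coefficient table scales the affine form. [folklore] -/
private theorem affForm_smul (c : R) (b : Option (Fin n) → R) :
    affForm (fun o => c * b o) = C c * affForm b := by
  simp only [affForm, map_mul, mul_add, Finset.mul_sum, mul_assoc]

/-- Ring homomorphisms act on the coefficient tables. [folklore] -/
private theorem map_affForm {S : Type*} [CommSemiring S] (φ : R →+* S) (b : Option (Fin n) → R) :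
    map φ (affForm b) = affForm (fun o => φ (b o)) := by
  simp only [affForm, map_add, map_sum, map_mul, map_C, map_X]

/-- Ring homomorphisms act on the coefficient tables. [folklore] -/
private theorem map_sps {S : Type*} [CommSemiring S] (φ : R →+* S)
    (a : Fin k → Fin d → Option (Fin n) → R) :
    map φ (sps a) = sps (fun i j o => φ (a i j o)) := by
  simp only [sps, map_sum, map_prod, map_affForm]

/-- `C c · (Σ^{[k]}Π^{[d]}Σ circuit)` is again one, for `d ≥ 1`: absorb `c` into the first affine
form of every product. [folklore] -/
private theorem C_mul_sps (hd : 0 < d) (c : R) (a : Fin k → Fin d → Option (Fin n) → R) :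
    C c * sps a = sps (fun i j o => if j = ⟨0, hd⟩ then c * a i j o else a i j o) := by
  classical
  unfold sps
  rw [Finset.mul_sum]
  refine Finset.sum_congr rfl fun i _ => ?_
  have key : ∀ j : Fin d, affForm (fun o => if j = ⟨0, hd⟩ then c * a i j o else a i j o) =
      (if j = ⟨0, hd⟩ then C c else 1) * affForm (a i j) := by
    intro j
    split_ifs with h
    · exact affForm_smul c (a i j)
    · exact (one_mul _).symm
  simp_rw [key]
  rw [Finset.prod_mul_distrib, Finset.prod_ite_eq']
  simp

/-- With `d = 0` every `Σ^{[k]}Π^{[0]}Σ` circuit is the constant `k`. [folklore] -/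
private theorem sps_zero (a : Fin k → Fin 0 → Option (Fin n) → R) : sps a = C (k : R) := by
  simp [sps]

/-- Affine forms have total degree `≤ 1`. [folklore] -/
private theorem totalDegree_affForm_le (b : Option (Fin n) → R) : (affForm b).totalDegree ≤ 1 := by
  unfold affForm
  refine (totalDegree_add _ _).trans (max_le ((totalDegree_C _).le.trans zero_le_one)
    (totalDegree_finsetSum_le fun v _ => ?_))
  rw [C_mul_X_eq_monomial]
  exact (totalDegree_monomial_le _ _).trans (by simp)

/-- `Σ^{[k]}Π^{[d]}Σ` circuits have total degree `≤ d`. [folklore] -/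
private theorem totalDegree_sps_le (a : Fin k → Fin d → Option (Fin n) → R) :
    (sps a).totalDegree ≤ d := by
  unfold sps
  refine totalDegree_finsetSum_le fun i _ => (totalDegree_finsetProd _ _).trans ?_
  calc ∑ j : Fin d, (affForm (a i j)).totalDegree ≤ ∑ _j : Fin d, 1 :=
        Finset.sum_le_sum fun j _ => totalDegree_affForm_le _
    _ = d := by simp

/-- An exponent with some entry `> d` has degree `> d`. [folklore] -/
private theorem lt_degree_of_not_forall_le {e : Fin n →₀ ℕ} (he : ¬ ∀ i, e i ≤ d) :
    d < ∑ i ∈ e.support, e i := by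
  push Not at he
  obtain ⟨i, hi⟩ := he
  have hmem : i ∈ e.support := Finsupp.mem_support_iff.2 (by omega)
  exact hi.trans_le (Finset.single_le_sum (fun j _ => Nat.zero_le (e j)) hmem)

/-- Coefficients of `Σ^{[k]}Π^{[d]}Σ` circuits vanish above degree `d`. [folklore] -/
private theorem coeff_sps_eq_zero (a : Fin k → Fin d → Option (Fin n) → R) {e : Fin n →₀ ℕ}
    (he : ¬ ∀ i, e i ≤ d) : coeff e (sps a) = 0 :=
  coeff_eq_zero_of_totalDegree_lt ((totalDegree_sps_le a).trans_lt (lt_degree_of_not_forall_le he))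

/-- The slot variables of the generic circuit: one per (product gate, factor, coefficient). [folklore] -/
abbrev Slot (k d n : ℕ) := Fin k × Fin d × Option (Fin n)

/-- The generic `Σ^{[k]}Π^{[d]}Σ` circuit, with indeterminate coefficients. [folklore] -/
def genSPS (k d n : ℕ) (F : Type*) [CommSemiring F] :
    MvPolynomial (Fin n) (MvPolynomial (Slot k d n) F) :=
  sps (fun i j o => X (i, j, o))

variable {F : Type*} [CommSemiring F]

/-- Every `Σ^{[k]}Π^{[d]}Σ` circuit over an `F`-algebra is a specialisation of the generic one,
coefficientwise: `coeff_e (sps a) = P_e(a)` with `P_e = coeff_e (genSPS)`. [folklore] -/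
private theorem coeff_sps_eq_aeval {A : Type*} [CommSemiring A] [Algebra F A]
    (a : Fin k → Fin d → Option (Fin n) → A) (e : Fin n →₀ ℕ) :
    coeff e (sps a) = aeval (fun s : Slot k d n => a s.1 s.2.1 s.2.2) (coeff e (genSPS k d n F)) := by
  have h : map (aeval (fun s : Slot k d n => a s.1 s.2.1 s.2.2)).toRingHom (genSPS k d n F) =
      sps a := by
    rw [genSPS, map_sps]
    simp only [AlgHom.toRingHom_eq_coe, RingHom.coe_coe, aeval_X]
  rw [← h, coeff_map]
  rfl

/-! ### The coefficient map is homogeneous of degree `d` in the slots -/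

variable {ι : Type*}

/-- All coefficients (in `x`) are homogeneous of degree `m` in the slot variables. [folklore] -/
private def CoeffHom (Q : MvPolynomial (Fin n) (MvPolynomial ι F)) (m : ℕ) : Prop :=
  ∀ e, (coeff e Q).IsHomogeneous m

/-- A constant (in `x`) with homogeneous slot-coefficient has homogeneous coefficients. [folklore] -/
private theorem coeffHom_C {s : MvPolynomial ι F} {m : ℕ} (hs : s.IsHomogeneous m) :
    CoeffHom (n := n) (C s) m := by
  classical
  intro e
  rw [coeff_C]
  split_ifs
  · exact hs
  · exact isHomogeneous_zero _ _ _

/-- A variable `x_v` has slot-homogeneous coefficients of degree `0`. [folklore] -/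
private theorem coeffHom_X (v : Fin n) : CoeffHom (X v : MvPolynomial (Fin n) (MvPolynomial ι F)) 0 := by
  classical
  intro e
  rw [coeff_X]
  split_ifs
  · exact isHomogeneous_one _ _
  · exact isHomogeneous_zero _ _ _

/-- `CoeffHom` is additive. [folklore] -/
private theorem coeffHom_add {A B : MvPolynomial (Fin n) (MvPolynomial ι F)} {m : ℕ} (hA : CoeffHom A m)
    (hB : CoeffHom B m) : CoeffHom (A + B) m := fun e => by
  rw [coeff_add]; exact (hA e).add (hB e)

/-- `CoeffHom` is closed under finite sums. [folklore] -/
private theorem coeffHom_sum {κ : Type*} (s : Finset κ) (u : κ → MvPolynomial (Fin n) (MvPolynomial ι F))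
    {m : ℕ} (h : ∀ i ∈ s, CoeffHom (u i) m) : CoeffHom (∑ i ∈ s, u i) m := fun e => by
  rw [coeff_sum]; exact IsHomogeneous.sum s _ m fun i hi => h i hi e

/-- `CoeffHom` is multiplicative (degrees add). [folklore] -/
private theorem coeffHom_mul {A B : MvPolynomial (Fin n) (MvPolynomial ι F)} {a b : ℕ} (hA : CoeffHom A a)
    (hB : CoeffHom B b) : CoeffHom (A * B) (a + b) := fun e => by
  classical
  rw [coeff_mul]
  exact IsHomogeneous.sum _ _ _ fun x _ => (hA x.1).mul (hB x.2)

/-- `CoeffHom` over a finite product of degree-`1` factors has degree the number of factors. [folklore] -/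
private theorem coeffHom_prod {κ : Type*} (s : Finset κ) (u : κ → MvPolynomial (Fin n) (MvPolynomial ι F))
    (h : ∀ i ∈ s, CoeffHom (u i) 1) : CoeffHom (∏ i ∈ s, u i) s.card := by
  classical
  induction s using Finset.induction_on with
  | empty =>
    intro e
    rw [Finset.prod_empty, Finset.card_empty, ← C_1]
    exact coeffHom_C (isHomogeneous_one _ _) e
  | insert a s ha ih =>
    rw [Finset.prod_insert ha, Finset.card_insert_of_notMem ha, add_comm]
    exact coeffHom_mul (h a (Finset.mem_insert_self a s))
      (ih fun i hi => h i (Finset.mem_insert_of_mem hi))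

/-- **The coefficient map of the generic `Σ^{[k]}Π^{[d]}Σ` circuit is homogeneous of degree `d`.**
[cite: BurgisserClausenShokrollahi1997, Thm. (20.24) (proof: homogeneous parametrisations)] -/
theorem coeffHom_genSPS : CoeffHom (genSPS k d n F) d := by
  unfold genSPS sps
  refine coeffHom_sum _ _ fun i _ => ?_
  have h := coeffHom_prod (Finset.univ : Finset (Fin d))
    (fun j => affForm (fun o => (X (i, j, o) : MvPolynomial (Slot k d n) F))) fun j _ => ?_
  · rwa [Finset.card_univ, Fintype.card_fin] at h
  · unfold affForm
    refine coeffHom_add (coeffHom_C (isHomogeneous_X _ _)) (coeffHom_sum _ _ fun v _ => ?_)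
    exact coeffHom_mul (coeffHom_C (isHomogeneous_X _ _)) (coeffHom_X v)

end Generic

/-! ## Zariski closure ⊆ ε-border for `Σ^{[k]}Π^{[d]}Σ` -/

section Main

variable {F : Type*} [Field F] {n k d : ℕ}

/-- The case `d = 0`: the class is the single constant `k`, and so is its closure. [folklore] -/
private theorem border_of_zariski_zero (f : MvPolynomial (Fin n) F)
    (hf : coeffVec f ∈ zariskiClosure
      (coeffVec '' {g : MvPolynomial (Fin n) F | MS2021.IsSPS k 0 g})) :
    f ∈ DDS2021.border (DDS2021.spsClass (RatFunc F) n k 0) := by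
  classical
  have hfeq : f = C (k : F) := by
    ext e
    have h := (mem_zariskiClosure_iff.1 hf)
      (X e - C (coeff e (C (k : F) : MvPolynomial (Fin n) F))) (by
        rintro _ ⟨g, hg, rfl⟩
        obtain ⟨a, rfl⟩ := isSPS_iff.1 hg
        rw [map_sub, aeval_X, aeval_C, coeffVec_apply, sps_zero, Algebra.algebraMap_self_apply,
          sub_self])
    rwa [map_sub, aeval_X, aeval_C, coeffVec_apply, Algebra.algebraMap_self_apply, sub_eq_zero] at h
  have hmem : MS2021.IsSPS k 0 (map (algebraMap F (RatFunc F)) f) :=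
    isSPS_iff.2 ⟨fun _ _ _ => 0, by rw [hfeq, map_C, map_natCast, sps_zero]⟩
  exact ⟨map (algebraMap F (RatFunc F)) f, hmem, DDS2021.isEpsApprox_map_algebraMap f⟩

/-- **Zariski closure ⊆ ε-border for `Σ^{[k]}Π^{[d]}Σ`, `d ≥ 1`** (curve selection + division of one
affine form per product by `ε^h`).
[cite: BurgisserClausenShokrollahi1997, Lemma (20.28), Thm. (20.24) (proof)] [cite: DuttaDwivediSaxena2022, Def. 2.1] -/
theorem border_of_zariski_pos [IsAlgClosed F] (hd : 0 < d) (f : MvPolynomial (Fin n) F)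
    (hf : coeffVec f ∈ zariskiClosure
      (coeffVec '' {g : MvPolynomial (Fin n) F | MS2021.IsSPS k d g})) :
    f ∈ DDS2021.border (DDS2021.spsClass (RatFunc F) n k d) := by
  classical
  -- consequences of `hf` for test polynomials
  have hvan : ∀ Q : MvPolynomial (Fin n →₀ ℕ) F,
      (∀ a : Fin k → Fin d → Option (Fin n) → F, aeval (coeffVec (sps a)) Q = 0) →
        aeval (coeffVec f) Q = 0 := fun Q hQ =>
    (mem_zariskiClosure_iff.1 hf) Q (by
      rintro _ ⟨g, hg, rfl⟩
      obtain ⟨a, rfl⟩ := isSPS_iff.1 hg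
      exact hQ a)
  have hfdeg : ∀ e : Fin n →₀ ℕ, ¬ (∀ i, e i ≤ d) → coeff e f = 0 := by
    intro e he
    have h := hvan (X e) fun a => by rw [aeval_X, coeffVec_apply, coeff_sps_eq_zero a he]
    rwa [aeval_X, coeffVec_apply] at h
  -- the finitely many relevant exponents
  haveI : Finite {e : Fin n →₀ ℕ // ∀ i, e i ≤ d} :=
    Finite.of_injective
      (fun t : {e : Fin n →₀ ℕ // ∀ i, e i ≤ d} => fun i : Fin n =>
        (⟨t.1 i, Nat.lt_succ_of_le (t.2 i)⟩ : Fin (d + 1)))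
      (by
        intro t t' h
        apply Subtype.ext
        ext i
        have hi := congr_fun h i
        simpa using congrArg Fin.val hi)
  -- the homogeneous coefficient map and the point
  set P : {e : Fin n →₀ ℕ // ∀ i, e i ≤ d} → MvPolynomial (Slot k d n) F :=
    fun t => coeff t.1 (genSPS k d n F) with hPdef
  have hP : ∀ t, (P t).IsHomogeneous d := fun t => coeffHom_genSPS t.1
  have hz : RingHom.ker (bind₁ P : MvPolynomial {e : Fin n →₀ ℕ // ∀ i, e i ≤ d} F →ₐ[F]
        MvPolynomial (Slot k d n) F) ≤
      RingHom.ker (aeval (fun t : {e : Fin n →₀ ℕ // ∀ i, e i ≤ d} => coeff t.1 f) :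
        MvPolynomial {e : Fin n →₀ ℕ // ∀ i, e i ≤ d} F →ₐ[F] F) := by
    intro q hq
    rw [RingHom.mem_ker] at hq ⊢
    have h := hvan (rename (fun t : {e : Fin n →₀ ℕ // ∀ i, e i ≤ d} => (t.1 : Fin n →₀ ℕ)) q)
      fun a => by
        rw [aeval_rename]
        have key : (coeffVec (sps a) ∘ fun t : {e : Fin n →₀ ℕ // ∀ i, e i ≤ d} => t.1) =
            fun t => aeval (fun s : Slot k d n => a s.1 s.2.1 s.2.2) (P t) := by
          funext t
          simp only [Function.comp_apply, coeffVec_apply, hPdef]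
          exact coeff_sps_eq_aeval (F := F) a t.1
        rw [key, ← aeval_bind₁, hq, map_zero]
    rwa [aeval_rename] at h
  -- curve selection
  obtain ⟨h, p, hp⟩ := exists_curve_of_ker_bind₁_le P hP hz
  -- the circuit along the curve, over `F[ε]`
  set Gp : MvPolynomial (Fin n) (Polynomial F) := sps (fun i j o => p (i, j, o)) with hGpdef
  have hGp : ∀ e, coeff e Gp = aeval p (coeff e (genSPS k d n F)) := fun e => by
    rw [hGpdef, coeff_sps_eq_aeval (F := F)]
  have hdiv : ∀ e : Fin n →₀ ℕ, ∃ w : Polynomial F,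
      coeff e Gp = Polynomial.X ^ h * w ∧ w.coeff 0 = coeff e f := by
    intro e
    by_cases he : ∀ i, e i ≤ d
    · have hpe := hp ⟨e, he⟩
      have hX : Polynomial.X ^ h ∣ coeff e Gp := by
        rw [Polynomial.X_pow_dvd_iff]
        intro j hj
        rw [hGp, hpe j hj.le, if_neg hj.ne]
      obtain ⟨w, hw⟩ := hX
      refine ⟨w, hw, ?_⟩
      calc w.coeff 0 = (Polynomial.X ^ h * w).coeff (0 + h) := (Polynomial.coeff_X_pow_mul w h 0).symm
        _ = (coeff e Gp).coeff h := by rw [← hw, zero_add]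
        _ = coeff e f := by rw [hGp, hpe h le_rfl, if_pos rfl]
    · refine ⟨0, ?_, ?_⟩
      · rw [mul_zero, hGpdef]
        exact coeff_sps_eq_zero _ he
      · rw [Polynomial.coeff_zero]
        exact (hfdeg e he).symm
  choose w hw hw0 using hdiv
  have hw_off : ∀ e ∉ Gp.support, w e = 0 := fun e he => by
    have h0 : Polynomial.X ^ h * w e = 0 := by rw [← hw e]; exact notMem_support_iff.1 he
    exact (mul_eq_zero.1 h0).resolve_left (pow_ne_zero _ Polynomial.X_ne_zero)
  -- divide by `ε^h`
  set G' : MvPolynomial (Fin n) (Polynomial F) := ∑ e ∈ Gp.support, monomial e (w e) with hG'def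
  have hG' : ∀ e, coeff e G' = w e := by
    intro e
    rw [hG'def, coeff_sum]
    simp only [coeff_monomial]
    rw [Finset.sum_ite_eq']
    split_ifs with he
    · rfl
    · exact (hw_off e he).symm
  have hCG : C (Polynomial.X ^ h) * G' = Gp := by
    ext e
    rw [coeff_C_mul, hG', ← hw]
  have hXh : (RatFunc.X : RatFunc F) ^ h ≠ 0 := pow_ne_zero _ RatFunc.X_ne_zero
  have hmapG' : map (algebraMap (Polynomial F) (RatFunc F)) G' =
      C ((RatFunc.X : RatFunc F) ^ h)⁻¹ * map (algebraMap (Polynomial F) (RatFunc F)) Gp := by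
    rw [← hCG, map_mul, map_C, map_pow, RatFunc.algebraMap_X, ← mul_assoc, ← map_mul,
      inv_mul_cancel₀ hXh, map_one, one_mul]
  refine ⟨map (algebraMap (Polynomial F) (RatFunc F)) G', ?_,
    DDS2021.isEpsApprox_iff_exists_map.2 ⟨G', rfl, ?_⟩⟩
  · -- membership in `Σ^{[k]}Π^{[d]}Σ(F(ε))`
    have hmem : MS2021.IsSPS k d (map (algebraMap (Polynomial F) (RatFunc F)) G') := by
      rw [hmapG', hGpdef, map_sps, C_mul_sps hd]
      exact isSPS_iff.2 ⟨_, rfl⟩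
    exact hmem
  · -- `G'(ε = 0) = f`
    ext e
    rw [coeff_map, hG', Polynomial.constantCoeff_apply, hw0]

/-- **Zariski closure ⊆ ε-border for `Σ^{[k]}Π^{[d]}Σ`** over an algebraically closed field.
[cite: BurgisserClausenShokrollahi1997, Lemma (20.28), Thm. (20.24)] [cite: DuttaDwivediSaxena2022, Def. 2.1, Def. 2.3] -/
theorem border_of_zariski [IsAlgClosed F] (n k d : ℕ) (f : MvPolynomial (Fin n) F)
    (hf : coeffVec f ∈ zariskiClosure
      (coeffVec '' {g : MvPolynomial (Fin n) F | MS2021.IsSPS k d g})) :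
    f ∈ DDS2021.border (DDS2021.spsClass (RatFunc F) n k d) := by
  rcases Nat.eq_zero_or_pos d with rfl | hd
  · exact border_of_zariski_zero f hf
  · exact border_of_zariski_pos hd f hf

/-- **`EpsOfZariskiSPS` in the lens-3 node's typed form** (verbatim the v3.1 signature; the
hypothesis `1 ≤ k` is not needed). [cite: BurgisserClausenShokrollahi1997, Thm. (20.24)] [cite: DuttaDwivediSaxena2022, Def. 2.1] -/
theorem epsOfZariskiSPS :
    ∀ (n k d : ℕ) (f : MvPolynomial (Fin n) ℂ), 1 ≤ k →
      coeffVec f ∈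
          zariskiClosure (coeffVec '' {g : MvPolynomial (Fin n) ℂ | MS2021.IsSPS k d g}) →
        f ∈ DDS2021.border (DDS2021.spsClass (RatFunc ℂ) n k d) :=
  fun n k d f _ hf => border_of_zariski n k d f hf

end Main

end EpsZariski

end Literature.Computability.AlgebraicComplexity
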